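import Mathlib
import HarnessLib
import HarnessLib.Audit
import Summits.NavierStokesRegularity.Statement
import Summits.NavierStokesRegularity.NavierStokesRegularity.Theses.TaoLadderRungThree
import Literature.Analysis.FluidPDE.Tao2016AveragedNS.RestartedCascadeFlows

/-!
Route: BarrierStepRungThree

DORMANT since 2026-09-02T17:24:24Z (reconciler: no traction for 5 d (last activity statement-checked at 2026-08-28T16:47:03Z); parked, not closed — `ledger route dormant route-NavierStokesRegularity-BarrierStepRungThree --off` to reacti) — unstaffed, not closed; items shared with open routes are served there. `ledger route dormant <id> --off` reactivates.

# Route BarrierStepRungThree — a robust eventuality (barrier + clock) certificate for the dyadic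
front step closes rung M3

It suffices to show X = BarrierCertificate ∧ BarrierSoundness (with the three CLOSED supports
RestartControl,
RestartGlue, LocalDynamicsSufficesAt of the host route TaoLadderRungThree, re-asked by name).
DICTIONARY (every
entry a tree decl): robust front step `FrontStepAt 1 R` of the restarted Tao cascade at λ = 2
(description slot
`P` arbitrary) ↦ robust finite-time EVENTUALITY property of the quadratic differential inclusion
S' ∈ quadTerm(S) + D_η(F) on a finite shell window [kLo, kLo+n) with the tail as bounded disturbance
↦ a
Prajna–Rantzer eventuality certificate: a C¹ clock/barrier function v on the window, a goal function
g, an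
outside profile (r,q,ρ) and envelopes (env, Ψ, Φ), subject ONLY to POINTWISE inequalities (datum,
properness,
clock floor, robust decrease ⟨∇v, quadTerm + d⟩ ≤ −γ, linear-in-|S_k| tail rate, goal ⇒
shifted/rescaled
description) ↦ the description P := {v ≤ 0, g > 0, outside energies ≤ r²/2, bounded}.
BarrierCertificate (∃):
some comparable table admits such data; BarrierSoundness (∀): any such data gives P(datum) ∧
RobustStep at
ε₀ = 1. This LINE bears on rung TL-M3 only; no summit (Clay A–D) is proved by it.
Lean:
`Summit.NavierStokesRegularity.NavierStokesRegularity.Theses.BarrierStepRungThree.BarrierCertificate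
∧ Summit.NavierStokesRegularity.NavierStokesRegularity.Theses.BarrierStepRungThree.BarrierSoundness`

## Assembly
BarrierCertificate supplies the data; BarrierSoundness turns it into P(datum) ∧ RobustStep 1;
RestartControl makes every
restarted flow of a putative global pseudo-solution an (η,η)-pseudo-flow from a P-state with
admissible slack and horizon ≥ c,
RobustStep steps it, RestartGlue extends the checkpoint chain, giving `DynamicsLocalAt 1 R`;
LocalDynamicsSufficesAt 1 R
yields the rung. The deciding theorem `closes` (glue.lean, kernel-checked, no sorry) is exactly this
plumbing.

CLOSES_TARGET: closes rung TL-M3 of NavierStokesRegularity: Summit.NavierStokesRegularity.NavierStokesRegularity.Theses.TaoLadderRungThree.Target (D-0061; not the summit Statement) — the deciding theorem of this route concludes that registered leaf instead of the Statement decl `NavierStokesRegularity` (class rung: servable and labelled, never counted as concluding the summit Statement).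

UNDER FLOOR: fewer than 2 cruxes remain after retriage (legacy route; D-0019).

Rationale: WHY THIS LINE. Rung M3 (`TaoLadderRungThree.Target`: some R-comparable symmetric cancelling
four-mode table has no global
Theorem-4.2-level pseudo-solution at the dyadic end ε₀ = 1) is attacked in the tree only by PRIMAL
witnesses:
interval enclosures of exact trajectories into a shrunken ball (`GapData`, TaoLadderRungThree
K_A/K_B; idea-2's
trapping/exact windows) or by structural unfoldings of the table (my gen-0 HeteroclinicTriggerChain,
idea-1's
ratchets). This line imports the DUAL witness of hybrid-systems verification: Prajna–Rantzer
eventuality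
certificates (doi:10.1137/050645178, Thm 3.5 and the robust form of §3.4, p. 1009: ⟨∂B/∂x, f(x,d)⟩ ≤
−ε on
(X∖X_r)×D), barrier certificates (Prajna–Jadbabaie, doi:10.1007/978-3-540-24743-2_32), searchable by
SOS/SDP
(Parrilo, doi:10.1007/s10107-003-0387-5) and rationalisable exactly (Peyrl–Parrilo,
doi:10.1016/j.tcs.2008.09.025),
as used for ODE/PDE bounds by auxiliary functions (Fantuzzi–Goluskin–Huang–Chernyshenko,
doi:10.1137/15M1053347)
and for trajectory funnels (LQR-trees, doi:10.1177/0278364910369189). What it does that prior routes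
do not:
the ∃-side is a set of pointwise polynomial inequalities (no ODE is integrated; a convex search
space; a
rational certificate is kernel-checkable by `nlinarith`/`polyrith`), and the ∀-side is a
comparison/bootstrap
theorem in which the infinite tail enters through a linear-in-|S_k| energy-rate clause (Gronwall in
√F_k), not
the open perturbation theory of `GappedFrontRobust`. The negatives index (3 NS entries) contains no
cascade statement. REV 5 (generation 3, RE-TYPING SUB-ROUTE): prover ns-bsr3-p1 showed the ∀-crux
BarrierSoundness AS TYPED is misstated (per-shell outside caps over infinitely many shells with a
two-sided tail rate fail 'from infinity' along a PseudoFlowOn) and PROVED the repaired ∀-side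
`Theorems.BarrierSoundness.barrierSoundness₃` (p590006; one-directional tail bookkeeping: tail SUMS
above the window with the recursion 2^{5(k−1)/2}(Σ|α_{·,(0,0,1)}|)q_{k−1}² ≤ ρ_k, base link
2Φ_{i,n−1} ≤ q_{kLo+n−1}², re-entry decay q_{k+1} ≤ 2^{−θ} r_k, per-coordinate caps Φ_ij and
properness Mw_ij; per-shell caps and TAIL RATE only below the window);
`Theorems.taoLadderRungThree_target_of_certificate₃` closes the loop. The deciding theorem now runs
through the re-typed pair BarrierCertificateR (∃, open) / BarrierSoundnessR (∀, = the type of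
barrierSoundness₃, closes by `exact`), with the same three CLOSED host supports; the rev-2 items
BarrierCertificate, BarrierSoundness, WindowCertificateMargin, PolynomialWindowCertificate are kept
in the file as ASIDES (settled format edges, never staffed). No statement about the Navier–Stokes
equations is made by any of this; the leaf is rung TL-M3.

RANKED CRUXES. #2 BarrierCertificateR (crux, ∃-design, XL) — SOME data (R ≥ 1, R-comparable table α,
one-shell datum, θ ∈ [0,1/2], c, η, γ > 0, window [kLo,kLo+n) ∋ 0,1, C¹ clock v, continuous goal g,
outside profile r < q with rate ρ and the one-directional recursion above the window, envelopes
env/Ψ, per-coordinate caps Φ_ij and properness Mw_ij, datum clauses, clock floor, ROBUST decrease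
⟨∇v(win S), quadTerm(S)|window + d⟩ ≤ −γ on the region, tail rate below the window, goal ⇒ rescaled
re-entry) satisfy VERBATIM the hypotheses of barrierSoundness₃ — why it might fail: no
time-independent C¹ clock with a UNIFORM rate may exist at λ = 2 for any comparable table (delayed
near-heteroclinic transit; ns-bsr3-p2's census j296033/j296154: 85–98 % of any quadratic region is
intrinsically bad, admissible tube 2–5 % of coordinate ranges, fragile direction = next trigger). #3
BarrierSoundnessR (crux, ∀-analysis) — the type of barrierSoundness₃: PROVED (p590006), closes at
once by `exact Theorems.BarrierSoundness.barrierSoundness₃`. #9 RestartControl, RestartGlue,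
LocalDynamicsSufficesAt (CLOSED host supports). In-tree reductions of #2 (all landed, provers
ns-bsr3-p1…p5): certificate₃_of_windowCertificateMargin₃ / …Split₃ (undisturbed decrease −(γ+δ) +
‖∇v‖ ≤ Λ + absorption budget, free margin split p592198),
certificate₃_of_polynomialWindowCertificate₃, the finite BOX template
taoLadderRungThree_target_of_boxCertificateKit (profile kit + WindowBox reduction: no ℤ-indexed
sequence, no energy variable, only the window and its two neighbours remain) and the TWO-FUNCTION
form WindowBox.taoLadderRungThree_target_of_twoFunctionCertificate₃ (tube h + clock w, v := w +
C·max(h,0)², p594676) — so #2 reduces to ONE rational certificate for ONE table.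

KILL CRITERIA. Unchanged in substance (critic P1 classification): bounded-degree SDP/LP
infeasibility — even with a dual (Farkas) certificate, even for three tables × two windows — REFUTES
NOTHING (#2 quantifies over arbitrary C¹ v, continuous g, all tables and windows); it is the
SEAT-POLICY trigger for `route close --reason exhausted` with the census (tables, windows, degrees,
units tried). What WOULD be refuted:BarrierCertificateR: a structural theorem that for every
comparable table at λ = 2 every robust front re-enters, after each restart, states where the window
restriction of quadTerm is arbitrarily small relative to the window energy while inside any
candidate region (seed coordinate → 0 ⇒ γ ≤ Λ·inf|quadTerm| = 0). A refutation of BarrierSoundnessR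
is impossible (it is a theorem). TaoLadderRungThree or HeteroclinicTriggerChain closing M3 moots the
line (superseded).

NOT DECOMPOSED YET. Layer 2 = the choice of table, window, degree, units and multipliers for the ONE
certificate. SCREEN-INFORMED INSTANCE (critic idea-crit-3 PRICE-UPDATE P2′ 2026-08-28T01:10Z;
provers ns-bsr3-p3/p5 kit j295586/j295744/j295780/j295919/j296050/j296083/j296115; all MODEL lane):
(a) TABLE: the gen-0 trigger-chain (HTC) table at λ = 2 in Tao normal form, β ∈ [2e−3, 5e−3]. (b)
WINDOW: kLo ∈ {−1, −2} and the window must reach shell 3 (admissible windows [−1,4) or [−2,4), n = 5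
or 6): kLo = 0 is INFEASIBLE by the tail-rate squeeze at the first shell below the window (c ≤
2.27–3.36 vs c ≥ 2T_hop = 3.88–5.70 at every β), while kLo = −1 passes ×2.5+ (c ≤ 11.9–22.5; c_max
6–14 ≫ c_min ≈ 1.1·T_goal with the free split); the CONFINEMENT-COST rule puts shells 2, 3 INSIDE
the window with soft caps (a stiff cap on a coordinate that moves by about its cap during the step
eats the decrease budget: u₂ as top shell costs ≈ 11× budget, shell 3 as top 0.08). The rev-2
sentence «the wake behind the front grows geometrically restart over restart, so the window must be
kLo = 0» is WITHDRAWN: it was a θ = 1/2 (threshold-unit) bookkeeping artefact — in PEAK-PHASE units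
the restarted HTC front is discretely self-similar (amplitude ratio μ_a = 0.857/0.901/0.925/0.943 at
the four screened β, profile converged by hop 3 over 17 shells, j295919), which is the best evidence
so far that ONE scaled window certificate serves every hop. (c) GOAL: homogeneous PHASE-LOCKED goal
g (ratio/linear form) ⇒ the restarted front is stationary in peak units (T_goal = 1.63/2.16/2.59,
re-entry amplitude a = 0.81/0.88/0.93 at β = 1e−2/3e−3/1e−3; DSS re-entry = start to 3 digits). (d)
EXPONENT: θ := −log₂ μ_a(β) ∈ [0.09, 0.22] (not 1/2). (e) MARGIN: free split −(γ+γ_d)/γ_d (tree: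
…windowCertificateMarginSplit₃), not −2γ/γ. (f) FORM: two-function certificate (polynomial TUBE h
from Stage A: inflow ∇h·F ≤ 0 on the box, free multiplier; CLOCK w from the linear Stage B on {h ≤
0}; witness v = w + C·max(h,0)², C¹) = hypotheses of
WindowBox.taoLadderRungThree_target_of_twoFunctionCertificate₃; the S-procedure kit (p593834) turns
each solver fact p − Σλ_i g_i ∈ SOS on the box into those implications. (g) DEGREE:
quadratic/quartic clocks are LP-feasible on 10 % tubes in peak units (β = 5e−3: γ* = 0.40, Λ = 6.8,
γ/Λ = 0.059, c ≈ 2.3 at degree 2; 0.50/9.1/0.055/2.0 at degree 4; β = 2e−3: γ/Λ = 0.045 (deg 2),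
0.039 (deg 4); no stagnation, min|f| = 0.36/0.30), hop-map Jacobian contracting (ρ ≈ 0.1) but
sheared (singular values 35–111) ⇒ Stage A tube in scaled coordinates.

CHEAPEST FALSIFIER. (0) DONE — orbit/tube LP screens (j293912/j294162 threshold units; j296083
PEAK-PHASE units, window {−1,0,1}+, HTC table): feasible (numbers above); an LP-infeasible orbit at
degree ≤ 6 would have predicted SDP infeasibility on the region. (1) NEXT, before more SOS money:
Stage A (tube invariance, scaled coordinates, adversarial behind/ahead shells through the explicit
caps |S_{·,kLo−1}| ≤ Q_b G, |S_{·,kLo+n}| ≤ 2cA₁2^{5(K−1)/2}q_top²) then Stage B (clock on the tube)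
as ONE kit SDP job in peak-phase units on the window [−1,4), degrees (h,w) ≤ (4,4), Putinar
multipliers ≤ 4; export exactly the hypotheses of …twoFunctionCertificate₃ / …boxCertificateKit,
rationalise (Peyrl–Parrilo; python-flint) and replay by nlinarith / the SProc kit. Report γ, c, Λ,
M, m_seed, absorption load, degree, window, units with every certificate or failure. A dual
infeasibility certificate up to degree 8 for (HTC table, windows [−1,4) and [−2,4)) and for the
cell's D64 table sends the line to `route close --reason exhausted` with the census (SEAT POLICY —
not a refutation).

NUMBERS. λ = 2; θ = −log₂ μ_a ∈ [0.09,0.22] (peak-phase units; μ_a = 0.857–0.943), θ ≤ 1/2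
admissible by the format; coupling weight of shell k in restarted units 2^(5k/2); defect weights
η·4^k; T_hop = 1.94–2.85, T_goal = 1.63–2.59; LP clocks: γ/Λ = 0.039–0.059 (peak units, 10 % tube),
seed floor m_seed ≈ 4.7·β; SOS Stage-B screens of record (threshold units, frozen boundary): γ* =
0.944 (hop 4, 4 pieces), 0.482 (hops 4–5, 6 pieces), scaled run γ* = 0.624 residual 1.5e−4
(j295095/j295110/j295964) — to be RE-RUN in peak-phase units (critic P2′). D64 screen: μ_∞ =
0.553625 (TaoLadderRungThree header). Prajna–Rantzer Thm 3.5 / robust form p. 1009: ⟨∂B/∂x, f(x,d)⟩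
≤ −ε on (X∖X_r)×D.

DEFINITION REQUESTS. None: every notion is a tree decl (`quadTerm`, `slackWeight`, `datumState`,
`datumEnergy`, `RobustStep`, `InTableClass`) or Mathlib (`fderiv`, `ContDiff`, `Finset.range`).

Novelty: Searches (2026-08-27): tree `rg "Prajna|barrier certificate|Putinar|eventuality certificate"
Summits/NavierStokesRegularity Literature` → hits only Literature/Algebra/Polynomial/Putinar*,
FunctionalMining/StretchingLaminateBurkholderCertF1, FluidComputer/KidaPelzSpeed, none under
TaoLadder*/Theses; `lit search --hybrid "barrier certificate polynomial reachability sum of squares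
Prajna"` → [corpus:book:blekherman2012 pp.116–160], [corpus:paper:doi-10-1137-050645178 p.8 Thm 3.5,
p.11 §3.4]; `lit search "Prajna Rantzer convex programs temporal verification"` → 5 corpus docs
incl. [corpus:paper:doi-10-1177-0278364910369189 p.27], [corpus:paper:arxiv-2208.08105 p.18]; `lit
search --hybrid "sum of squares Lyapunov auxiliary function bounds shell model turbulence"` →
[corpus:book:ditlevsen2010 p.98], [corpus:book:bohr1998 p.3] (no SOS certificate for a shell-model
transit); `lit galaxy search "barrier certificate|Prajna" --star pdf` and `"shell model|dyadic
model" --star pdf` → no relevant hits (6 + 5 off-topic).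
Nearest prior art found: doi:10.1137/050645178 (Prajna–Rantzer 2007, eventuality certificates for
finite-dimensional C¹ systems with disturbance); in the tree, route TaoLadderRungThree (GapData
interval-enclosure certificate, same rung) and idea-2 TrappingWindowRungThree (trapping window).
Delta: the eventuality certificate is transplanted to Tao's infinite restarted lattice with energy
defects and made RESTART-COMPATIBLE (goal ⇒ shifted rescaled description, tail by a line  [refs: 10.1137/050645178, book:blekherman2012, paper:doi-10-1137-050645178, paper:doi-10-1177-0278364910369189, paper:arxiv-2208.08105, book:ditlevsen2010, book:bohr1998, doi:10.1137/050645178]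

Barriers (technique_class: barrier-certificate, sos-dual-witness, cascade-restart): - technique_class: barrier-certificate, sos-dual-witness, cascade-restart
- Literature.Barriers.NavierStokesRegularity.RobustCounterObstruction: outside — Cotler–Rezchikov
Thm 4.20/4.24 forbid ROBUST simulation of the unary counter by a finite-dimensional flow preserving
a finite smooth measure; the restarted cascade is an infinite lattice with scale covariance (the
step N ↦ N+1 is read in RESCALED coordinates, decoder regions are not μ-disjoint sets of measure
bounded below), and the inviscid cascade with defects preserves no smooth finite measure on the
region.
- Literature.Barriers.NavierStokesRegularity.DyadicCascadeRegularity: outside — BMR-type regularity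
is for positive dyadic models with dissipation strong relative to the transfer exponent; rung M3
concerns Tao's energy-supercritical (exponent 5/2) four-mode tables with defect terms, where
Tao2016AveragedNS Thm 4.2 gives blow-up at small ε₀; the certificate is table-specific and makes no
claim for the KP/Obukhov dyadic model.
- Literature.Barriers.NavierStokesRegularity.TaoAveragedBlowup: the CEILING of the whole Tao ladder
(averaged-NS blow-up never transfers to NS); this line claims rung M3 only. (The vocabulary entries
AveragedEquationStepTest — averaging-insensitive REGULARITY steps — and LocalStepIterationZeno —
regularity by restarting local existence — do not quantify over a model-side blow-up crux; the
geometric epoch clock summing to a finite time is the mechanism of Thm 4.2, not a bug.)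
- Negatives index: 3

History (route lifecycle, newest last):
- 2026-08-28T00:06:50Z · rev 4: informal re-worded for stmt-NavierStokesRegularity-23942 (planner-ns-idea-4-g2-0)
- 2026-09-02T17:24:24Z · DORMANT — reconciler: no traction for 5 d (last activity statement-checked at 2026-08-28T16:47:03Z); parked, not closed — `ledger route dormant route-NavierStokesRegulari (operator:999:4043276)

sub-problem: NavierStokesRegularity · status: dormant · opened planner-ns-idea-4-g2-0 2026-08-27T23:13:02Z · rev 6 · ledger route-NavierStokesRegularity-BarrierStepRungThree
GENERATED by the gate from the ledger (D-0016/17). Provers cite these decls: `theorem foo : Summit.NavierStokesRegularity.NavierStokesRegularity.Theses.BarrierStepRungThree.<Decl> := …` in Summits/NavierStokesRegularity/NavierStokesRegularity/Theorems/<Name>.lean.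
-/

namespace Summit.NavierStokesRegularity.NavierStokesRegularity.Theses.BarrierStepRungThree

open scoped BigOperators Topology Manifold Classical MeasureTheory ProbabilityTheory Matrix InnerProductSpace ComplexConjugate ContinuousMap
open Filter Set Function TopologicalSpace MeasureTheory

attribute [summit_statement] _root_.NavierStokesRegularity
attribute [summit_statement] _root_.Summit.NavierStokesRegularity.NavierStokesRegularity.Theses.TaoLadderRungThree.Target

open Literature.NS

/-- item stmt-NavierStokesRegularity-24513 · crux · rank 2 · open · by planner
why it might fail: No time-independent C¹ clock with a UNIFORM rate γ > 0 may exist at λ = 2 for any comparable table: delayed near-heteroclinic transit; ns-bsr3-p2 census j296154 — 85–98 % of any quadratic region bad, admissible tube 2–5 %, fragile next-trigger direction.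
sources: doi:10.1137/050645178, doi:10.1007/978-3-540-24743-2_32, doi:10.1007/s10107-003-0387-5, doi:10.1016/j.tcs.2008.09.025, Tao2016AveragedNS
[crux] RE-TYPED ∃-side (generation 3; replaces BarrierCertificate as the load-bearing ∃-crux): SOME
data — R ≥ 1, an R-comparable symmetric cancelling table α, one-shell datum (i₀, X₀), exponents 0 ≤
θ ≤ 1/2, clock c > 0, defect margin η > 0, rate γ > 0, window [kLo, kLo+n) ∋ 0, 1, C¹ clock/barrier
v and continuous goal g on ℝ^{4n}, outside profile r < q with rate ρ (r + cρ ≤ q) obeying the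
ONE-DIRECTIONAL recursion 2^{5(k−1)/2}(Σ|α_{·,(0,0,1)}|) q_{k−1}² ≤ ρ_k and the re-entry decay
q_{k+1} ≤ 2^{−θ} r_k above the window, envelopes env ≥ q²/2 and Ψ ≥ every slackWeight,
per-coordinate window caps Φ_ij (base link 2Φ_{i,n−1} ≤ q_{kLo+n−1}², Mw_ij²/2 + ηΨ +
η4^{kLo+j}cΦ_ij < Φ_ij) and properness bounds Mw_ij, weighted tail bound — satisfy: v(datum) ≤ 0 <
g(datum); v ≤ 0 ⇒ |x_ij| ≤ Mw_ij; v ≤ 0 ∧ g > 0 ⇒ v > −γc; ROBUST DECREASE ⟨∇v(win S),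
quadTerm(S)|window + d⟩ ≤ −γ on the region for every defect |d_ij| ≤ η4^{kLo+j}√Φ_ij; TAIL RATE
quadTerm_k(S)·S_k ≤ ρ_k|S_k| below the window; GOAL ⇒ |S_{i₀,1}| ≥ 2^{−θ} and the shifted rescaled
window state re-enters {v ≤ 0 < g} with the low caps. VERBATIM the hypothesis of the tree theorem
`Theorems.taoLadderRungThree_target_of_certificate₃` (= the -/
@[route_item "route-NavierStokesRegularity-BarrierStepRungThree"]
def BarrierCertificateR : Prop :=
  ∃ (R θ c η γ : ℝ) (i₀ : Fin 4) (α : Fin 4 → Fin 4 → Fin 4 → ℤ × ℤ × ℤ → ℝ) (X₀ : Fin 4 → ℝ) (n : ℕ) (kLo : ℤ) (v g : (Fin 4 → Fin n → ℝ) → ℝ) (r q ρ env Ψ : ℤ → ℝ) (Mw Φ : Fin 4 → Fin n → ℝ) (win : (Fin 4 → ℤ → ℝ) → (Fin 4 → Fin n → ℝ)) (vf : (Fin 4 → ℤ → ℝ) → (Fin 4 → ℤ → ℝ)), 1 ≤ R ∧ Literature.Analysis.FluidPDE.TaoCascade.InTableClass R α ∧ X₀ i₀ ≠ 0 ∧ 0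 ≤ θ ∧ θ ≤ 1 / 2 ∧ 0 < c ∧ 0 < η ∧ 0 < γ ∧ kLo ≤ 0 ∧ (2 : ℤ) ≤ kLo + n ∧ (∀ (S : Fin 4 → ℤ → ℝ) (i : Fin 4) (j : Fin n), win S i j = S i (kLo + (j : ℕ))) ∧ (∀ (S : Fin 4 → ℤ → ℝ) (i : Fin 4) (k : ℤ), vf S i k = Literature.Analysis.FluidPDE.TaoCascade.quadTerm 1 α (fun i' k' (_ : ℝ) => S i' k') i k 0) ∧ ContDiff ℝ 1 v ∧ Continuous g ∧ (∀ (L' : ℕ) (k : ℤ), Literature.Analysis.FluidPDE.TaoCascade.slackWeight 1 θ c env L' k ≤ Ψ k) ∧ (∀ k : ℤ, 0 ≤ r k ∧ r k < q k ∧ 0 ≤ ρ k ∧ r k + c * ρ k ≤ q k ∧ q k ^ 2 / 2 ≤ env k) ∧ (∀ k : ℤ, kLo + n ≤ k → (1 + 1 : ℝ) ^ ((5 : ℝ) * ((k - 1 : ℤ) : ℝ) / 2) * (∑ i₁ : Fin 4, ∑ i₂ : Fin 4, ∑ i₃ : Fin 4, |α i₁ i₂ i₃ (0, 0, 1)|)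 * q (k - 1) ^ 2 ≤ ρ k) ∧ (∀ (i : Fin 4) (j : Fin n), (j : ℕ) + 1 = n → 2 * Φ i j ≤ q (kLo + (j : ℕ)) ^ 2) ∧ (∀ k : ℤ, kLo + n ≤ k → q (k + 1) ≤ (1 + 1 : ℝ) ^ (-θ) * r k) ∧ (∀ (i : Fin 4) (j : Fin n), 0 ≤ Φ i j ∧ Φ i j ≤ env (kLo + (j : ℕ)) ∧ Mw i j ^ 2 / 2 + η * Ψ (kLo + (j : ℕ)) + η * (1 + 1 : ℝ) ^ ((2 : ℝ) * ((kLo + (j : ℕ) : ℤ) : ℝ)) * c * Φ i j < Φ i j) ∧ (∃ M₁ : ℝ, ∀ k : ℤ, kLo + n ≤ k → (1 + (1 + 1 : ℝ) ^ ((10 : ℝ) * (k : ℝ))) * q k ≤ M₁) ∧ v (win (Literature.Analysis.FluidPDE.TaoCascade.datumState i₀ X₀)) ≤ 0 ∧ 0 < g (win (Literature.Analysis.FluidPDE.TaoCascade.datumState i₀ X₀)) ∧ (∀ x : Fin 4 → Fin n → ℝ, v x ≤ 0 → ∀ i j, |x i j| ≤ Mw i j) ∧ (∀ x : Fin 4 →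 Fin n → ℝ, v x ≤ 0 → 0 < g x → -(γ * c) < v x) ∧ (∀ (S F : Fin 4 → ℤ → ℝ) (d : Fin 4 → Fin n → ℝ), (v (win S) ≤ 0 ∧ (∀ i k, S i k ^ 2 ≤ 2 * F i k) ∧ (∀ i k, 0 ≤ F i k) ∧ (∀ i k, (k < kLo ∨ kLo + n ≤ k) → F i k ≤ q k ^ 2 / 2) ∧ (∀ (i : Fin 4) (j : Fin n), F i (kLo + (j : ℕ)) ≤ Φ i j)) → 0 < g (win S) → (∀ (i : Fin 4) (j : Fin n), |d i j| ≤ η * (1 + 1 : ℝ) ^ ((2 : ℝ) * ((kLo + (j : ℕ) : ℤ) : ℝ)) * Real.sqrt (Φ i j)) → (fderiv ℝ v (win S)) (fun i j => vf S i (kLo + (j : ℕ)) + d i j) ≤ -γ) ∧ (∀ (S F : Fin 4 → ℤ → ℝ), (v (win S) ≤ 0 ∧ (∀ i k, S i k ^ 2 ≤ 2 * F i k) ∧ (∀ i k, 0 ≤ F i k) ∧ (∀ i k, (k < kLo ∨ kLo + n ≤ k) → F i k ≤ q k ^ 2 / 2) ∧ (∀ (i : Fin 4) (j : Fin n), F i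 (kLo + (j : ℕ)) ≤ Φ i j)) → ∀ (i : Fin 4) (k : ℤ), k < kLo → vf S i k * S i k ≤ ρ k * |S i k|) ∧ (∀ (S F : Fin 4 → ℤ → ℝ), (v (win S) ≤ 0 ∧ (∀ i k, S i k ^ 2 ≤ 2 * F i k) ∧ (∀ i k, 0 ≤ F i k) ∧ (∀ i k, (k < kLo ∨ kLo + n ≤ k) → F i k ≤ q k ^ 2 / 2) ∧ (∀ (i : Fin 4) (j : Fin n), F i (kLo + (j : ℕ)) ≤ Φ i j)) → g (win S) ≤ 0 → (1 + 1 : ℝ) ^ (-θ) ≤ |S i₀ 1| ∧ v (win (fun i k => S i (1 + k) / |S i₀ 1|)) ≤ 0 ∧ 0 < g (win (fun i k => S i (1 + k) / |S i₀ 1|)) ∧ (∀ i k, k < kLo → F i (1 + k) / |S i₀ 1| ^ 2 ≤ r k ^ 2 / 2))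

/-- item stmt-NavierStokesRegularity-23420 · aside · rank 2 · SPLIT (gen 1) into WindowCertificateMargin, DisturbanceAbsorption + glue BarrierCertificateGlue · direct attempts still welcome (low priority) · by planner
why it might fail: a time-independent C¹ clock v with UNIFORM decrease on the whole region may not exist at λ = 2 (transit through a slow bottleneck near the one-shell state; backscatter monomials X_(n+1)² make the window non-isolable), even if a robust front exists.
sources: doi:10.1137/050645178, doi:10.1007/978-3-540-24743-2_32, doi:10.1177/0278364910369189, Tao2016AveragedNS
[crux] Some R ≥ 1, some R-comparable symmetric cancelling table α, datum (i₀, X₀), exponents 0 ≤ θ ≤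
1/2, clock c > 0, margin η > 0, rate γ > 0, window [kLo, kLo+n) ∋ 0,1, C¹ clock/barrier v and
continuous goal g on the window, outside profile r < q with rate ρ (r + cρ ≤ q), envelopes env ≥
q²/2, Ψ ≥ every slackWeight, window energy caps Φ with M²/2 + ηΨ + η4^k cΦ < Φ, and weighted tail
bound, satisfy: v(datum) ≤ 0 < g(datum); v ≤ 0 ⇒ |x| ≤ M; v ≤ 0 ∧ g > 0 ⇒ v > −γc; ROBUST DECREASE
⟨∇v(win S), quadTerm(S)|_window + d⟩ ≤ −γ for every region state and every disturbance |d_ij| ≤ η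
4^(kLo+j) √Φ_j; TAIL RATE quadTerm_k(S)·S_k ≤ ρ_k |S_k| outside the window; GOAL ⇒ |S_(i₀,1)| ≥
2^(−θ) and the shifted, rescaled state is again in the description. [difficulty: XL] -/
@[route_item "route-NavierStokesRegularity-BarrierStepRungThree"]
def BarrierCertificate : Prop :=
  ∃ (R θ c η γ M : ℝ) (i₀ : Fin 4) (α : Fin 4 → Fin 4 → Fin 4 → ℤ × ℤ × ℤ → ℝ) (X₀ : Fin 4 → ℝ) (n : ℕ) (kLo : ℤ) (v g : (Fin 4 → Fin n → ℝ) → ℝ) (r q ρ env Ψ : ℤ → ℝ) (Φ : Fin n → ℝ) (win : (Fin 4 → ℤ → ℝ) → (Fin 4 → Fin n → ℝ)) (vf : (Fin 4 → ℤ → ℝ) → (Fin 4 → ℤ → ℝ)), 1 ≤ R ∧ Literature.Analysis.FluidPDE.TaoCascade.InTableClass R α ∧ X₀ i₀ ≠ 0 ∧ 0 ≤ θ ∧ θ ≤ 1 / 2 ∧ 0 < c ∧ 0 < η ∧ 0 < γ ∧ kLo ≤ 0 ∧ (2 : ℤ) ≤ kLo + n ∧ (∀ (S : Fin 4 → ℤ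 → ℝ) (i : Fin 4) (j : Fin n), win S i j = S i (kLo + (j : ℕ))) ∧ (∀ (S : Fin 4 → ℤ → ℝ) (i : Fin 4) (k : ℤ), vf S i k = Literature.Analysis.FluidPDE.TaoCascade.quadTerm 1 α (fun i' k' (_ : ℝ) => S i' k') i k 0) ∧ ContDiff ℝ 1 v ∧ Continuous g ∧ (∀ (L' : ℕ) (k : ℤ), Literature.Analysis.FluidPDE.TaoCascade.slackWeight 1 θ c env L' k ≤ Ψ k) ∧ (∀ k : ℤ, 0 ≤ r k ∧ r k < q k ∧ 0 ≤ ρ k ∧ r k + c * ρ k ≤ q k ∧ q k ^ 2 / 2 ≤ env k) ∧ (∀ j : Fin n, 0 ≤ Φ j ∧ Φ j ≤ env (kLo + (j : ℕ)) ∧ M ^ 2 / 2 + η * Ψ (kLo + (j : ℕ)) + η * (1 + 1 : ℝ) ^ ((2 : ℝ) * ((kLo + (j : ℕ) : ℤ) : ℝ)) * c * Φ j < Φ j) ∧ (∃ M₁ : ℝ, ∀ k : ℤ, kLo + n ≤ k → (1 + (1 + 1 : ℝ) ^ ((10 : ℝ) * (k : ℝ))) * q k ≤ M₁) ∧ v (win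 (Literature.Analysis.FluidPDE.TaoCascade.datumState i₀ X₀)) ≤ 0 ∧ 0 < g (win (Literature.Analysis.FluidPDE.TaoCascade.datumState i₀ X₀)) ∧ (∀ x : Fin 4 → Fin n → ℝ, v x ≤ 0 → ∀ i j, |x i j| ≤ M) ∧ (∀ x : Fin 4 → Fin n → ℝ, v x ≤ 0 → 0 < g x → -(γ * c) < v x) ∧ (∀ (S F : Fin 4 → ℤ → ℝ) (d : Fin 4 → Fin n → ℝ), (v (win S) ≤ 0 ∧ (∀ i k, S i k ^ 2 ≤ 2 * F i k) ∧ (∀ i k, 0 ≤ F i k) ∧ (∀ i k, (k < kLo ∨ kLo + n ≤ k) → F i k ≤ q k ^ 2 / 2) ∧ (∀ (i : Fin 4) (j : Fin n), F i (kLo + (j : ℕ)) ≤ Φ j)) → 0 < g (win S) → (∀ (i : Fin 4) (j : Fin n), |d i j| ≤ η * (1 + 1 : ℝ) ^ ((2 : ℝ) * ((kLo + (j : ℕ) : ℤ) : ℝ)) * Real.sqrt (Φ j)) → (fderiv ℝ v (win S)) (fun i j => vf S i (kLo + (j : ℕ)) + d i j) ≤ -γ) ∧ (∀ (S F : Fin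 4 → ℤ → ℝ), (v (win S) ≤ 0 ∧ (∀ i k, S i k ^ 2 ≤ 2 * F i k) ∧ (∀ i k, 0 ≤ F i k) ∧ (∀ i k, (k < kLo ∨ kLo + n ≤ k) → F i k ≤ q k ^ 2 / 2) ∧ (∀ (i : Fin 4) (j : Fin n), F i (kLo + (j : ℕ)) ≤ Φ j)) → ∀ (i : Fin 4) (k : ℤ), (k < kLo ∨ kLo + n ≤ k) → vf S i k * S i k ≤ ρ k * |S i k|) ∧ (∀ (S F : Fin 4 → ℤ → ℝ), (v (win S) ≤ 0 ∧ (∀ i k, S i k ^ 2 ≤ 2 * F i k) ∧ (∀ i k, 0 ≤ F i k) ∧ (∀ i k, (k < kLo ∨ kLo + n ≤ k) → F i k ≤ q k ^ 2 / 2) ∧ (∀ (i : Fin 4) (j : Fin n), F i (kLo + (j : ℕ)) ≤ Φ j)) → g (win S) ≤ 0 → (1 + 1 : ℝ) ^ (-θ) ≤ |S i₀ 1| ∧ v (win (fun i k => S i (1 + k) / |S i₀ 1|)) ≤ 0 ∧ 0 < g (win (fun i k => S i (1 + k) / |S i₀ 1|)) ∧ (∀ i k, (k < kLo ∨ kLo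 + n ≤ k) → F i (1 + k) / |S i₀ 1| ^ 2 ≤ r k ^ 2 / 2))

-- parent: BarrierCertificate · child (gen 1)
/--     item stmt-NavierStokesRegularity-23648 · aside · rank 201 · open
    parent: BarrierCertificate · by planner
    why it might fail: No polynomial clock/barrier of SDP-tractable degree may exist for any comparable table at λ=2: the transit is a delayed near-heteroclinic excursion (long quiescent phase forces high degree for uniform decrease γ), and sr-nssos records 286/309 negative SOS searches on NS truncations.
    sources: doi:10.1137/050645178, doi:10.1007/s10107-003-0387-5, doi:10.1016/j.tcs.2008.09.025, doi:10.1137/15M1053347, Literature.Algebra.Polynomial.PutinarPositivstellensatz, LADDER-NS N7 sr-nssos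
[crux] SOS-READY WINDOW CERTIFICATE WITH MARGIN (split gen 1 of BarrierCertificate; the dictionary's
checkable end). Same data and clauses as BarrierCertificate for SOME comparable table, except that
the decrease clause is UNDISTURBED — ⟨∇v(win S), quadTerm(S)|window⟩ ≤ −2γ on REGION ∩ {g > 0} — and
comes with an operator-norm bound ‖fderiv v x‖ ≤ Λ on {v ≤ 0} and the absorption budget
Λ·η·4^(kLo+j)·√Φ_j ≤ γ. Every clause is a polynomial (or norm) inequality in finitely many real
variables (window states, two boundary shells, window energies), so for polynomial (v,g) of bounded
degree it is a Putinar/quadratic-module membership problem (tree: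
Literature.Algebra.Polynomial.PutinarPositivstellensatz `truncQuadraticModule`,
`eval_nonneg_of_mem_quadraticModule`) = one SDP feasibility instance per (table, window, degree);
rational rounding (Peyrl–Parrilo) makes it kernel-checkable by nlinarith. Intended instance: 3-shell
window kLo = −1, n = 3 at λ = 2 for the cell's D64 screen table or the gen-0 trigger-chain table. -/
@[route_item "route-NavierStokesRegularity-BarrierStepRungThree"]
def WindowCertificateMargin : Prop :=
  ∃ (R θ c η γ M : ℝ) (i₀ : Fin 4) (α : Fin 4 → Fin 4 → Fin 4 → ℤ × ℤ × ℤ → ℝ) (X₀ : Fin 4 → ℝ) (n : ℕ) (kLo : ℤ) (v g : (Fin 4 → Fin n → ℝ) → ℝ) (r q ρ env Ψ : ℤ → ℝ) (Φ : Fin n → ℝ) (win : (Fin 4 → ℤ → ℝ) → (Fin 4 → Fin n → ℝ)) (vf : (Fin 4 → ℤ → ℝ) → (Fin 4 → ℤ → ℝ)) (Λ : ℝ), 1 ≤ R ∧ Literature.Analysis.FluidPDE.TaoCascade.InTableClass R α ∧ X₀ i₀ ≠ 0 ∧ 0 ≤ θ ∧ θ ≤ 1 / 2 ∧ 0 < c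 ∧ 0 < η ∧ 0 < γ ∧ kLo ≤ 0 ∧ (2 : ℤ) ≤ kLo + n ∧ (∀ (S : Fin 4 → ℤ → ℝ) (i : Fin 4) (j : Fin n), win S i j = S i (kLo + (j : ℕ))) ∧ (∀ (S : Fin 4 → ℤ → ℝ) (i : Fin 4) (k : ℤ), vf S i k = Literature.Analysis.FluidPDE.TaoCascade.quadTerm 1 α (fun i' k' (_ : ℝ) => S i' k') i k 0) ∧ ContDiff ℝ 1 v ∧ Continuous g ∧ (∀ (L' : ℕ) (k : ℤ), Literature.Analysis.FluidPDE.TaoCascade.slackWeight 1 θ c env L' k ≤ Ψ k) ∧ (∀ k : ℤ, 0 ≤ r k ∧ r k < q k ∧ 0 ≤ ρ k ∧ r k + c * ρ k ≤ q k ∧ q k ^ 2 / 2 ≤ env k) ∧ (∀ j : Fin n, 0 ≤ Φ j ∧ Φ j ≤ env (kLo + (j : ℕ)) ∧ M ^ 2 / 2 + η * Ψ (kLo + (j : ℕ)) + η * (1 + 1 : ℝ) ^ ((2 : ℝ) * ((kLo + (j : ℕ) : ℤ) : ℝ)) * c * Φ j < Φ j) ∧ (∃ M₁ : ℝ, ∀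 k : ℤ, kLo + n ≤ k → (1 + (1 + 1 : ℝ) ^ ((10 : ℝ) * (k : ℝ))) * q k ≤ M₁) ∧ v (win (Literature.Analysis.FluidPDE.TaoCascade.datumState i₀ X₀)) ≤ 0 ∧ 0 < g (win (Literature.Analysis.FluidPDE.TaoCascade.datumState i₀ X₀)) ∧ (∀ x : Fin 4 → Fin n → ℝ, v x ≤ 0 → ∀ i j, |x i j| ≤ M) ∧ (∀ x : Fin 4 → Fin n → ℝ, v x ≤ 0 → 0 < g x → -(γ * c) < v x) ∧ (∀ (S F : Fin 4 → ℤ → ℝ), (v (win S) ≤ 0 ∧ (∀ i k, S i k ^ 2 ≤ 2 * F i k) ∧ (∀ i k, 0 ≤ F i k) ∧ (∀ i k, (k < kLo ∨ kLo + n ≤ k) → F i k ≤ q k ^ 2 / 2) ∧ (∀ (i : Fin 4) (j : Fin n), F i (kLo + (j : ℕ)) ≤ Φ j)) → 0 < g (win S) → (fderiv ℝ v (win S)) (fun i j => vf S i (kLo + (j : ℕ))) ≤ -(2 * γ)) ∧ (∀ x : Fin 4 → Fin n → ℝ, v x ≤ 0 → ‖fderiv ℝ v x‖ ≤ Λ)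 ∧ 0 ≤ Λ ∧ (∀ j : Fin n, Λ * (η * (1 + 1 : ℝ) ^ ((2 : ℝ) * ((kLo + (j : ℕ) : ℤ) : ℝ)) * Real.sqrt (Φ j)) ≤ γ) ∧ (∀ (S F : Fin 4 → ℤ → ℝ), (v (win S) ≤ 0 ∧ (∀ i k, S i k ^ 2 ≤ 2 * F i k) ∧ (∀ i k, 0 ≤ F i k) ∧ (∀ i k, (k < kLo ∨ kLo + n ≤ k) → F i k ≤ q k ^ 2 / 2) ∧ (∀ (i : Fin 4) (j : Fin n), F i (kLo + (j : ℕ)) ≤ Φ j)) → ∀ (i : Fin 4) (k : ℤ), (k < kLo ∨ kLo + n ≤ k) → vf S i k * S i k ≤ ρ k * |S i k|) ∧ (∀ (S F : Fin 4 → ℤ → ℝ), (v (win S) ≤ 0 ∧ (∀ i k, S i k ^ 2 ≤ 2 * F i k) ∧ (∀ i k, 0 ≤ F i k) ∧ (∀ i k, (k < kLo ∨ kLo + n ≤ k) → F i k ≤ q k ^ 2 / 2) ∧ (∀ (i : Fin 4) (j : Fin n), F i (kLo + (j : ℕ)) ≤ Φ j)) → g (win S) ≤ 0 → (1 + 1 :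 ℝ) ^ (-θ) ≤ |S i₀ 1| ∧ v (win (fun i k => S i (1 + k) / |S i₀ 1|)) ≤ 0 ∧ 0 < g (win (fun i k => S i (1 + k) / |S i₀ 1|)) ∧ (∀ i k, (k < kLo ∨ kLo + n ≤ k) → F i (1 + k) / |S i₀ 1| ^ 2 ≤ r k ^ 2 / 2))

-- parent: BarrierCertificate · child (gen 1)
/--     item stmt-NavierStokesRegularity-23649 · support · rank 202 · closed · proved by Summit.NavierStokesRegularity.NavierStokesRegularity.Theorems.disturbanceAbsorption_proof (prover)
    parent: BarrierCertificate · by planner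
[support] DISTURBANCE ABSORPTION LEMMA (split gen 1 of BarrierCertificate; finite-dimensional,
table-free): linearity of the Fréchet derivative and the operator-norm bound ‖fderiv v x‖ ≤ Λ (sup
norm on Fin 4 → Fin n → ℝ, so ‖d‖ = max |d i j| ≤ max_j η·4^(kLo+j)·√Φ_j) turn an undisturbed
decrease (fderiv v x) w ≤ −2γ plus the budget Λ·η·4^(kLo+j)·√Φ_j ≤ γ into (fderiv v x)(w + d) ≤ −γ
for every defect d in the box. Routine (S/M): `map_add`, `ContinuousLinearMap.le_opNorm`,
`pi_norm_le_iff`. The glue WindowCertificateMargin → DisturbanceAbsorption → BarrierCertificate is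
clause plumbing: take the margin certificate's data, copy every clause, and produce the robust
decrease clause from this lemma at x = win S, w = (quadTerm restricted to the window). -/
@[route_item "route-NavierStokesRegularity-BarrierStepRungThree"]
def DisturbanceAbsorption : Prop :=
  ∀ (n : ℕ) (kLo : ℤ) (η γ Λ : ℝ) (v : (Fin 4 → Fin n → ℝ) → ℝ) (Φ : Fin n → ℝ) (x w d : Fin 4 → Fin n → ℝ), 0 ≤ γ → 0 ≤ Λ → (fderiv ℝ v x) w ≤ -(2 * γ) → ‖fderiv ℝ v x‖ ≤ Λ → (∀ j : Fin n, 0 ≤ Φ j) → (∀ j : Fin n, Λ * (η * (1 + 1 : ℝ) ^ ((2 : ℝ) * ((kLo + (j : ℕ) : ℤ) : ℝ)) * Real.sqrt (Φ j)) ≤ γ) → (∀ (i : Fin 4) (j : Fin n), |d i j| ≤ η * (1 + 1 : ℝ) ^ ((2 : ℝ) * ((kLo + (j : ℕ) : ℤ) : ℝ)) * Real.sqrt (Φ j)) → (fderiv ℝ v x) (w + d) ≤ -γ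

-- `DisturbanceAbsorption` holds: proved by `Summit.NavierStokesRegularity.NavierStokesRegularity.Theorems.disturbanceAbsorption_proof` (its module imports this route file, so no `_holds` link can be stated here).

-- parent: BarrierCertificate · glue (gen 1)
/--     item stmt-NavierStokesRegularity-23650 · support · rank 203 · closed · proved by Summit.NavierStokesRegularity.NavierStokesRegularity.Theorems.barrierCertificateGlue_proof (prover)
    parent: BarrierCertificate · GLUE: children ⟹ parent · by planner
WindowCertificateMargin → DisturbanceAbsorption → BarrierCertificate: clause plumbing — take the
margin certificate's data (R … vf, Λ), copy every clause of BarrierCertificate verbatim except the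
robust decrease, which is DisturbanceAbsorption at x = win S, w = window restriction of quadTerm(S),
d the defect; cf. BarrierCertificate_of in the registered birth skeleton -/
@[route_item "route-NavierStokesRegularity-BarrierStepRungThree"]
def BarrierCertificateGlue : Prop :=
  WindowCertificateMargin → DisturbanceAbsorption → BarrierCertificate

-- `BarrierCertificateGlue` holds: proved by `Summit.NavierStokesRegularity.NavierStokesRegularity.Theorems.barrierCertificateGlue_proof` (its module imports this route file, so no `_holds` link can be stated here).

/-- item stmt-NavierStokesRegularity-23421 · aside · rank 3 · open · by planner
why it might fail: a bookkeeping mismatch between the pointwise clauses and `PseudoFlowOn` (one-sided `derivWithin` at s = 0, strictness at first exit when ρ_k = 0 and r_k = q_k is excluded but Φ-touchdown needs the strict cap) could make the comparison fail as typed; then it is refuted-misstated, not substantive.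
sources: doi:10.1137/050645178, Tao2016AveragedNS, doi:10.1137/15M1053347
[crux] For ALL data as in BarrierCertificate, the description P(S,F) := v(win S) ≤ 0 ∧ 0 < g(win S)
∧ F ≥ 0 ∧ (outside energies ≤ r²/2) ∧ (∃ B, F ≤ B) holds at the rescaled datum and every
(η,η)-pseudo-flow (`PseudoFlowOn`) from a P-state with admissible slack on a horizon τ ≥ c admits a
checkpoint step `StepTo` with envelope `epochEnvelope env` — i.e. `RobustStep 1 θ c η i₀ α P env`.
Proof shape: first-exit bootstrap of the region (window energies via (4.10), outside energies via
(4.9) and the linear tail rate: √F_k(s) ≤ (r_k + sρ_k)/√2), chain rule for v ∘ win ∘ S with the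
defect as disturbance, clock floor ⇒ goal reached at some 0 < τ₁ ≤ c, goal clause ⇒ StepTo with a =
|S_(i₀,1)(τ₁)|; P's boundedness clause from `apriori_F`. [difficulty: L] -/
@[route_item "route-NavierStokesRegularity-BarrierStepRungThree"]
def BarrierSoundness : Prop :=
  ∀ (R θ c η γ M : ℝ) (i₀ : Fin 4) (α : Fin 4 → Fin 4 → Fin 4 → ℤ × ℤ × ℤ → ℝ) (X₀ : Fin 4 → ℝ) (n : ℕ) (kLo : ℤ) (v g : (Fin 4 → Fin n → ℝ) → ℝ) (r q ρ env Ψ : ℤ → ℝ) (Φ : Fin n → ℝ) (win : (Fin 4 → ℤ → ℝ) → (Fin 4 → Fin n → ℝ)) (vf : (Fin 4 → ℤ → ℝ) → (Fin 4 → ℤ → ℝ)), 1 ≤ R ∧ Literature.Analysis.FluidPDE.TaoCascade.InTableClass R α ∧ X₀ i₀ ≠ 0 ∧ 0 ≤ θ ∧ θ ≤ 1 / 2 ∧ 0 < c ∧ 0 < η ∧ 0 < γ ∧ kLo ≤ 0 ∧ (2 : ℤ) ≤ kLo + n ∧ (∀ (S : Fin 4 → ℤ → ℝ) (i : Fin 4)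 (j : Fin n), win S i j = S i (kLo + (j : ℕ))) ∧ (∀ (S : Fin 4 → ℤ → ℝ) (i : Fin 4) (k : ℤ), vf S i k = Literature.Analysis.FluidPDE.TaoCascade.quadTerm 1 α (fun i' k' (_ : ℝ) => S i' k') i k 0) ∧ ContDiff ℝ 1 v ∧ Continuous g ∧ (∀ (L' : ℕ) (k : ℤ), Literature.Analysis.FluidPDE.TaoCascade.slackWeight 1 θ c env L' k ≤ Ψ k) ∧ (∀ k : ℤ, 0 ≤ r k ∧ r k < q k ∧ 0 ≤ ρ k ∧ r k + c * ρ k ≤ q k ∧ q k ^ 2 / 2 ≤ env k) ∧ (∀ j : Fin n, 0 ≤ Φ j ∧ Φ j ≤ env (kLo + (j : ℕ)) ∧ M ^ 2 / 2 + η * Ψ (kLo + (j : ℕ)) + η * (1 + 1 : ℝ) ^ ((2 : ℝ) * ((kLo + (j : ℕ) : ℤ) : ℝ)) * c * Φ j < Φ j) ∧ (∃ M₁ : ℝ, ∀ k : ℤ, kLo + n ≤ k → (1 + (1 + 1 : ℝ) ^ ((10 : ℝ) * (k : ℝ))) * q k ≤ M₁) ∧ v (win (Literature.Analysis.FluidPDE.TaoCascade.datumState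 i₀ X₀)) ≤ 0 ∧ 0 < g (win (Literature.Analysis.FluidPDE.TaoCascade.datumState i₀ X₀)) ∧ (∀ x : Fin 4 → Fin n → ℝ, v x ≤ 0 → ∀ i j, |x i j| ≤ M) ∧ (∀ x : Fin 4 → Fin n → ℝ, v x ≤ 0 → 0 < g x → -(γ * c) < v x) ∧ (∀ (S F : Fin 4 → ℤ → ℝ) (d : Fin 4 → Fin n → ℝ), (v (win S) ≤ 0 ∧ (∀ i k, S i k ^ 2 ≤ 2 * F i k) ∧ (∀ i k, 0 ≤ F i k) ∧ (∀ i k, (k < kLo ∨ kLo + n ≤ k) → F i k ≤ q k ^ 2 / 2) ∧ (∀ (i : Fin 4) (j : Fin n), F i (kLo + (j : ℕ)) ≤ Φ j)) → 0 < g (win S) → (∀ (i : Fin 4) (j : Fin n), |d i j| ≤ η * (1 + 1 : ℝ) ^ ((2 : ℝ) * ((kLo + (j : ℕ) : ℤ) : ℝ)) * Real.sqrt (Φ j)) → (fderiv ℝ v (win S)) (fun i j => vf S i (kLo + (j : ℕ)) + d i j) ≤ -γ) ∧ (∀ (S F : Fin 4 → ℤ → ℝ), (v (win S) ≤ 0 ∧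 (∀ i k, S i k ^ 2 ≤ 2 * F i k) ∧ (∀ i k, 0 ≤ F i k) ∧ (∀ i k, (k < kLo ∨ kLo + n ≤ k) → F i k ≤ q k ^ 2 / 2) ∧ (∀ (i : Fin 4) (j : Fin n), F i (kLo + (j : ℕ)) ≤ Φ j)) → ∀ (i : Fin 4) (k : ℤ), (k < kLo ∨ kLo + n ≤ k) → vf S i k * S i k ≤ ρ k * |S i k|) ∧ (∀ (S F : Fin 4 → ℤ → ℝ), (v (win S) ≤ 0 ∧ (∀ i k, S i k ^ 2 ≤ 2 * F i k) ∧ (∀ i k, 0 ≤ F i k) ∧ (∀ i k, (k < kLo ∨ kLo + n ≤ k) → F i k ≤ q k ^ 2 / 2) ∧ (∀ (i : Fin 4) (j : Fin n), F i (kLo + (j : ℕ)) ≤ Φ j)) → g (win S) ≤ 0 → (1 + 1 : ℝ) ^ (-θ) ≤ |S i₀ 1| ∧ v (win (fun i k => S i (1 + k) / |S i₀ 1|)) ≤ 0 ∧ 0 < g (win (fun i k => S i (1 + k) / |S i₀ 1|)) ∧ (∀ i k, (k < kLo ∨ kLo + n ≤ k) → F i (1 + k) / |S i₀ 1| ^ 2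 ≤ r k ^ 2 / 2)) → (fun S F => v (win S) ≤ 0 ∧ 0 < g (win S) ∧ (∀ i k, 0 ≤ F i k) ∧ (∀ i k, (k < kLo ∨ kLo + n ≤ k) → F i k ≤ r k ^ 2 / 2) ∧ ∃ B : ℝ, ∀ i k, F i k ≤ B) (Literature.Analysis.FluidPDE.TaoCascade.datumState i₀ X₀) (Literature.Analysis.FluidPDE.TaoCascade.datumEnergy i₀ X₀) ∧ Literature.Analysis.FluidPDE.TaoCascade.RobustStep 1 θ c η i₀ α (fun S F => v (win S) ≤ 0 ∧ 0 < g (win S) ∧ (∀ i k, 0 ≤ F i k) ∧ (∀ i k, (k < kLo ∨ kLo + n ≤ k) → F i k ≤ r k ^ 2 / 2) ∧ ∃ B : ℝ, ∀ i k, F i k ≤ B) env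

/-- item stmt-NavierStokesRegularity-24514 · support · rank 3 · closed · proved by Summit.NavierStokesRegularity.NavierStokesRegularity.Theorems.barrierSoundnessR_proof (prover) · by planner
why it might fail: It cannot fail as typed: it is the exact type of the landed theorem barrierSoundness₃ (p590006); the residual risk is only a namespace/elaboration mismatch at the `exact` (checked rc 0 in the planner's Sketch.lean).
sources: p590006, Theorems/BarrierStepRungThreeBarrierSoundnessThree.lean
[crux] RE-TYPED ∀-side (generation 3; replaces BarrierSoundness, which is misstated as typed —
per-shell outside caps over infinitely many shells with a two-sided tail rate fail from infinity
along a PseudoFlowOn, prover ns-bsr3-p1): for ALL data as in BarrierCertificateR, the description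
P′(S,F) := v(win S) ≤ 0 ∧ 0 < g(win S) ∧ F ≥ 0 ∧ (F_{·,k} ≤ r_k²/2 for k < kLo) ∧ (all partial tail
sums Σ_{j<L}Σ_i F_{i,k+j} ≤ r_k²/2 for k ≥ kLo+n) ∧ (∃ D, S = F = 0 at every shell k with k + D <
kLo) ∧ (∃ B, F ≤ B) holds at the rescaled one-shell datum, and every (η,η)-pseudo-flow from a
P′-state with admissible slack on a horizon τ ≥ c admits a checkpoint step: `RobustStep 1 θ c η i₀ α
P′ env`. This is LITERALLY the type of the landed theorem
`Theorems.BarrierSoundness.barrierSoundness₃` (p590006, file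
BarrierStepRungThreeBarrierSoundnessThree.lean; Prajna–Rantzer eventuality made restart-compatible:
empty low block stays empty, first-exit bootstrap by real induction on the closed constraints, clock
+ floor ⇒ first goal time τ₁ ∈ (0,c], goal ⇒ re-entry with D ↦ D+1) — it closes by `exact`. MODEL
rung TL-M3; nothing here is about the Navier–Stokes equations. [difficulty: provable-now] -/
@[route_item "route-NavierStokesRegularity-BarrierStepRungThree"]
def BarrierSoundnessR : Prop :=
  ∀ (R θ c η γ : ℝ) (i₀ : Fin 4) (α : Fin 4 → Fin 4 → Fin 4 → ℤ × ℤ × ℤ → ℝ) (X₀ : Fin 4 → ℝ) (n : ℕ) (kLo : ℤ) (v g : (Fin 4 → Fin n → ℝ) → ℝ) (r q ρ env Ψ : ℤ → ℝ) (Mw Φ : Fin 4 → Fin n → ℝ) (win : (Fin 4 → ℤ → ℝ) → (Fin 4 → Fin n → ℝ)) (vf : (Fin 4 → ℤ → ℝ) → (Fin 4 → ℤ → ℝ)), 1 ≤ R ∧ Literature.Analysis.FluidPDE.TaoCascade.InTableClass R α ∧ X₀ i₀ ≠ 0 ∧ 0 ≤ θ ∧ θ ≤ 1 / 2 ∧ 0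 < c ∧ 0 < η ∧ 0 < γ ∧ kLo ≤ 0 ∧ (2 : ℤ) ≤ kLo + n ∧ (∀ (S : Fin 4 → ℤ → ℝ) (i : Fin 4) (j : Fin n), win S i j = S i (kLo + (j : ℕ))) ∧ (∀ (S : Fin 4 → ℤ → ℝ) (i : Fin 4) (k : ℤ), vf S i k = Literature.Analysis.FluidPDE.TaoCascade.quadTerm 1 α (fun i' k' (_ : ℝ) => S i' k') i k 0) ∧ ContDiff ℝ 1 v ∧ Continuous g ∧ (∀ (L' : ℕ) (k : ℤ), Literature.Analysis.FluidPDE.TaoCascade.slackWeight 1 θ c env L' k ≤ Ψ k) ∧ (∀ k : ℤ, 0 ≤ r k ∧ r k < q k ∧ 0 ≤ ρ k ∧ r k + c * ρ k ≤ q k ∧ q k ^ 2 / 2 ≤ env k) ∧ (∀ k : ℤ, kLo + n ≤ k → (1 + 1 : ℝ) ^ ((5 : ℝ) * ((k - 1 : ℤ) : ℝ) / 2) * (∑ i₁ : Fin 4, ∑ i₂ : Fin 4, ∑ i₃ : Fin 4, |α i₁ i₂ i₃ (0, 0, 1)|) * q (k - 1) ^ 2 ≤ ρ k) ∧ (∀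 (i : Fin 4) (j : Fin n), (j : ℕ) + 1 = n → 2 * Φ i j ≤ q (kLo + (j : ℕ)) ^ 2) ∧ (∀ k : ℤ, kLo + n ≤ k → q (k + 1) ≤ (1 + 1 : ℝ) ^ (-θ) * r k) ∧ (∀ (i : Fin 4) (j : Fin n), 0 ≤ Φ i j ∧ Φ i j ≤ env (kLo + (j : ℕ)) ∧ Mw i j ^ 2 / 2 + η * Ψ (kLo + (j : ℕ)) + η * (1 + 1 : ℝ) ^ ((2 : ℝ) * ((kLo + (j : ℕ) : ℤ) : ℝ)) * c * Φ i j < Φ i j) ∧ (∃ M₁ : ℝ, ∀ k : ℤ, kLo + n ≤ k → (1 + (1 + 1 : ℝ) ^ ((10 : ℝ) * (k : ℝ))) * q k ≤ M₁) ∧ v (win (Literature.Analysis.FluidPDE.TaoCascade.datumState i₀ X₀)) ≤ 0 ∧ 0 < g (win (Literature.Analysis.FluidPDE.TaoCascade.datumState i₀ X₀)) ∧ (∀ x : Fin 4 → Fin n → ℝ, v x ≤ 0 → ∀ i j, |x i j| ≤ Mw i j) ∧ (∀ x : Fin 4 → Fin n → ℝ, v x ≤ 0 → 0 < g x → -(γ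 * c) < v x) ∧ (∀ (S F : Fin 4 → ℤ → ℝ) (d : Fin 4 → Fin n → ℝ), (v (win S) ≤ 0 ∧ (∀ i k, S i k ^ 2 ≤ 2 * F i k) ∧ (∀ i k, 0 ≤ F i k) ∧ (∀ i k, (k < kLo ∨ kLo + n ≤ k) → F i k ≤ q k ^ 2 / 2) ∧ (∀ (i : Fin 4) (j : Fin n), F i (kLo + (j : ℕ)) ≤ Φ i j)) → 0 < g (win S) → (∀ (i : Fin 4) (j : Fin n), |d i j| ≤ η * (1 + 1 : ℝ) ^ ((2 : ℝ) * ((kLo + (j : ℕ) : ℤ) : ℝ)) * Real.sqrt (Φ i j)) → (fderiv ℝ v (win S)) (fun i j => vf S i (kLo + (j : ℕ)) + d i j) ≤ -γ) ∧ (∀ (S F : Fin 4 → ℤ → ℝ), (v (win S) ≤ 0 ∧ (∀ i k, S i k ^ 2 ≤ 2 * F i k) ∧ (∀ i k, 0 ≤ F i k) ∧ (∀ i k, (k < kLo ∨ kLo + n ≤ k) → F i k ≤ q k ^ 2 / 2) ∧ (∀ (i : Fin 4) (j : Fin n), F i (kLo + (j : ℕ)) ≤ Φ i j)) → ∀ (i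 : Fin 4) (k : ℤ), k < kLo → vf S i k * S i k ≤ ρ k * |S i k|) ∧ (∀ (S F : Fin 4 → ℤ → ℝ), (v (win S) ≤ 0 ∧ (∀ i k, S i k ^ 2 ≤ 2 * F i k) ∧ (∀ i k, 0 ≤ F i k) ∧ (∀ i k, (k < kLo ∨ kLo + n ≤ k) → F i k ≤ q k ^ 2 / 2) ∧ (∀ (i : Fin 4) (j : Fin n), F i (kLo + (j : ℕ)) ≤ Φ i j)) → g (win S) ≤ 0 → (1 + 1 : ℝ) ^ (-θ) ≤ |S i₀ 1| ∧ v (win (fun i k => S i (1 + k) / |S i₀ 1|)) ≤ 0 ∧ 0 < g (win (fun i k => S i (1 + k) / |S i₀ 1|)) ∧ (∀ i k, k < kLo → F i (1 + k) / |S i₀ 1| ^ 2 ≤ r k ^ 2 / 2)) → (fun S F => v (win S) ≤ 0 ∧ 0 < g (win S) ∧ (∀ i k, 0 ≤ F i k) ∧ (∀ i k, k < kLo → F i k ≤ r k ^ 2 / 2) ∧ (∀ k : ℤ, kLo + n ≤ k → ∀ L : ℕ, ∑ j ∈ Finset.range L, ∑ i, F i (k + j) ≤ r k ^ 2 / 2)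 ∧ (∃ D : ℕ, ∀ i k, k + D < kLo → S i k = 0 ∧ F i k = 0) ∧ ∃ B : ℝ, ∀ i k, F i k ≤ B) (Literature.Analysis.FluidPDE.TaoCascade.datumState i₀ X₀) (Literature.Analysis.FluidPDE.TaoCascade.datumEnergy i₀ X₀) ∧ Literature.Analysis.FluidPDE.TaoCascade.RobustStep 1 θ c η i₀ α (fun S F => v (win S) ≤ 0 ∧ 0 < g (win S) ∧ (∀ i k, 0 ≤ F i k) ∧ (∀ i k, k < kLo → F i k ≤ r k ^ 2 / 2) ∧ (∀ k : ℤ, kLo + n ≤ k → ∀ L : ℕ, ∑ j ∈ Finset.range L, ∑ i, F i (k + j) ≤ r k ^ 2 / 2) ∧ (∃ D : ℕ, ∀ i k, k + D < kLo → S i k = 0 ∧ F i k = 0) ∧ ∃ B : ℝ, ∀ i k, F i k ≤ B) env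

-- `BarrierSoundnessR` holds: proved by `Summit.NavierStokesRegularity.NavierStokesRegularity.Theorems.barrierSoundnessR_proof` (its module imports this route file, so no `_holds` link can be stated here).

/-- item stmt-NavierStokesRegularity-22990 · support · rank 9 · closed · proved by Summit.NavierStokesRegularity.NavierStokesRegularity.Theorems.barrierStepRungThree_restartGlue_proof (prover) · by planner
sources: Tao2016AveragedNS
[support] Definitional bookkeeping, VERBATIM the tree item stmt-NavierStokesRegularity-20425
(PROVED, Theorems/TaoLadderRungThreeRestartGlue.lean; table- and shift-set-free, so it is shared as
is): a `StepTo` of the flow restarted at checkpoint (N, t_N, e_N) is a level-(N+1)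
`EpochCheckpoints` of the original family with t_(N+1) = t_N + τ₁/γ and e_(N+1) = a·e_N.
[difficulty: provable-now] -/
@[route_item "route-NavierStokesRegularity-BarrierStepRungThree"]
def RestartGlue : Prop :=
  ∀ (ε₀ θ c : ℝ) (m : ℕ) (i₀ : Fin m) (n₀ : ℤ) (X₀ : Fin m → ℝ) (P Q : (Fin m → ℤ → ℝ) → (Fin m → ℤ → ℝ) → Prop) (N : ℤ) (X E : Fin m → ℤ → ℝ → ℝ) (t e : ℤ → ℝ) (τ₁ a : ℝ), 0 < ε₀ → n₀ ≤ N → Literature.Analysis.FluidPDE.TaoCascade.EpochCheckpoints ε₀ θ c i₀ n₀ X₀ P Q N X E t e → Literature.Analysis.FluidPDE.TaoCascade.StepTo ε₀ θ c i₀ P Q (Literature.Analysis.FluidPDE.TaoCascade.restartX ε₀ N (t N) (e N) X) (Literature.Analysis.FluidPDE.TaoCascade.restartE ε₀ N (t N) (e N) E) τ₁ a → Literature.Analysis.FluidPDE.TaoCascade.EpochCheckpoints ε₀ θ c i₀ n₀ X₀ P Q (N + 1) X E (Function.update t (N + 1) (t N + τ₁ / (e N * (1 + ε₀) ^ ((5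 : ℝ) * N / 2)))) (Function.update e (N + 1) (a * e N))

-- `RestartGlue` holds: proved by `Summit.NavierStokesRegularity.NavierStokesRegularity.Theorems.barrierStepRungThree_restartGlue_proof` (its module imports this route file, so no `_holds` link can be stated here).

/-- item stmt-NavierStokesRegularity-23422 · support · rank 9 · closed · proved by Summit.NavierStokesRegularity.NavierStokesRegularity.Theorems.barrierStepRungThree_restartControl_proof (prover) · by planner
sources: Tao2016AveragedNS
[support] (shared with TaoLadderRungThree, CLOSED) restarted flows of a global pseudo-solution at a
checkpoint are (η,η)-pseudo-flows with admissible slack, for n₀ large. [difficulty: provable-now] -/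
@[route_item "route-NavierStokesRegularity-BarrierStepRungThree"]
def RestartControl : Prop :=
  ∀ (ε₀ θ c η : ℝ) (i₀ : Fin 4) (α : Fin 4 → Fin 4 → Fin 4 → ℤ × ℤ × ℤ → ℝ) (X₀ : Fin 4 → ℝ) (P : (Fin 4 → ℤ → ℝ) → (Fin 4 → ℤ → ℝ) → Prop) (env : ℤ → ℝ) (K₁ K₂ : ℝ), 0 < ε₀ → θ ≤ 1 / 2 → 0 ≤ c → 0 < η → X₀ i₀ ≠ 0 → 0 ≤ K₁ → 0 ≤ K₂ → ∃ N₀ : ℤ, ∀ n₀ : ℤ, N₀ ≤ n₀ → ∀ T : ℝ, 0 < T → ∀ X E : Fin 4 → ℤ → ℝ → ℝ, Literature.Analysis.FluidPDE.TaoCascade.CascadeODESolutionOn T ε₀ α K₁ K₂ n₀ X₀ X E → ∀ N : ℤ, n₀ ≤ N → ∀ t e : ℤ → ℝ, Literature.Analysis.FluidPDE.TaoCascade.EpochCheckpoints ε₀ θ c i₀ n₀ X₀ P (Literature.Analysis.FluidPDE.TaoCascade.epochEnvelope env) N X E t e → t N < T → Literature.Analysis.FluidPDE.TaoCascade.PseudoFlowOn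 ((T - t N) * (e N * (1 + ε₀) ^ ((5 : ℝ) * N / 2))) ε₀ α η η (fun i k => X i (N + k) (t N) / e N) (fun i k => E i (N + k) (t N) / e N ^ 2) (Literature.Analysis.FluidPDE.TaoCascade.restartSlack ε₀ K₂ N (t N) (e N) E) (Literature.Analysis.FluidPDE.TaoCascade.restartX ε₀ N (t N) (e N) X) (Literature.Analysis.FluidPDE.TaoCascade.restartE ε₀ N (t N) (e N) E) ∧ ∀ i k, 0 ≤ Literature.Analysis.FluidPDE.TaoCascade.restartSlack ε₀ K₂ N (t N) (e N) E i k ∧ Literature.Analysis.FluidPDE.TaoCascade.restartSlack ε₀ K₂ N (t N) (e N) E i k ≤ η * Literature.Analysis.FluidPDE.TaoCascade.slackWeight ε₀ θ c env (N - n₀).toNat k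

-- `RestartControl` holds: proved by `Summit.NavierStokesRegularity.NavierStokesRegularity.Theorems.barrierStepRungThree_restartControl_proof` (its module imports this route file, so no `_holds` link can be stated here).

/-- item stmt-NavierStokesRegularity-23423 · support · rank 9 · closed · proved by Summit.NavierStokesRegularity.NavierStokesRegularity.Theorems.barrierStepRungThree_localDynamicsSufficesAt_proof (prover) · by planner
sources: Tao2016AveragedNS
[support] (shared with TaoLadderRungThree, CLOSED) `DynamicsLocalAt ε₀ R` implies some R-comparable
table has `NoGlobalCascade ε₀`. [difficulty: provable-now] -/
@[route_item "route-NavierStokesRegularity-BarrierStepRungThree"]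
def LocalDynamicsSufficesAt : Prop :=
  ∀ ε₀ R : ℝ, 0 < ε₀ → 1 ≤ R → Literature.Analysis.FluidPDE.TaoCascade.DynamicsLocalAt ε₀ R → ∃ (α : Fin 4 → Fin 4 → Fin 4 → ℤ × ℤ × ℤ → ℝ) (X₀ : Fin 4 → ℝ), Literature.Analysis.FluidPDE.TaoCascade.InTableClass R α ∧ Literature.Analysis.FluidPDE.TaoCascade.NoGlobalCascade ε₀ α X₀

-- `LocalDynamicsSufficesAt` holds: proved by `Summit.NavierStokesRegularity.NavierStokesRegularity.Theorems.barrierStepRungThree_localDynamicsSufficesAt_proof` (its module imports this route file, so no `_holds` link can be stated here).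

/-- item stmt-NavierStokesRegularity-23942 · aside · rank 9 · open · by planner
[support] POLYNOMIAL window certificate: WindowCertificateMargin with v, g restricted to evaluations
of real MvPolynomials of total degree ≤ 8 / ≤ 4 in the window coordinates (C¹/continuity dropped —
stub_polyEval_contDiff); = stub_polynomialCertificate of the registered 23648 skeleton ⇒ implies
WindowCertificateMargin. ROLE: exact SDP/Putinar search target; a per-(table, window, degree)
infeasibility dual is theorem-shaped (Negative lemma) but does not refute this ∃-over-tables item.
Why it might fail: bounded degree too rigid near the one-shell bottleneck (sr-nssos 286/309
negative); tube LP kit j294162: quartic clock feasible on a 10% tube (γ* = 0.112, Λ = 5.05); Stage A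
open. Sources: doi:10.1137/050645178 Thm 3.5; Putinar 1993; kit j293912/j294162. -/
@[route_item "route-NavierStokesRegularity-BarrierStepRungThree"]
def PolynomialWindowCertificate : Prop :=
  ∃ (R θ c η γ M : ℝ) (i₀ : Fin 4) (α : Fin 4 → Fin 4 → Fin 4 → ℤ × ℤ × ℤ → ℝ) (X₀ : Fin 4 → ℝ) (n : ℕ) (kLo : ℤ) (v g : (Fin 4 → Fin n → ℝ) → ℝ) (r q ρ env Ψ : ℤ → ℝ) (Φ : Fin n → ℝ) (win : (Fin 4 → ℤ → ℝ) → (Fin 4 → Fin n → ℝ)) (vf : (Fin 4 → ℤ → ℝ) → (Fin 4 → ℤ → ℝ)) (Λ : ℝ), (∃ (pv pg : MvPolynomial (Fin 4 × Fin n) ℝ), pv.totalDegree ≤ 8 ∧ pg.totalDegree ≤ 4 ∧ (∀ x : Fin 4 → Fin n → ℝ, v x = MvPolynomial.eval (fun ij : Fin 4 × Fin n => x ij.1 ij.2) pv) ∧ (∀ x : Fin 4 → Fin n → ℝ, g x = MvPolynomial.eval (fun ij : Fin 4 × Fin n => x ij.1 ij.2) pg)) ∧ 1 ≤ R ∧ Literature.Analysis.FluidPDE.TaoCascade.InTableClass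 R α ∧ X₀ i₀ ≠ 0 ∧ 0 ≤ θ ∧ θ ≤ 1 / 2 ∧ 0 < c ∧ 0 < η ∧ 0 < γ ∧ kLo ≤ 0 ∧ (2 : ℤ) ≤ kLo + n ∧ (∀ (S : Fin 4 → ℤ → ℝ) (i : Fin 4) (j : Fin n), win S i j = S i (kLo + (j : ℕ))) ∧ (∀ (S : Fin 4 → ℤ → ℝ) (i : Fin 4) (k : ℤ), vf S i k = Literature.Analysis.FluidPDE.TaoCascade.quadTerm 1 α (fun i' k' (_ : ℝ) => S i' k') i k 0) ∧ (∀ (L' : ℕ) (k : ℤ), Literature.Analysis.FluidPDE.TaoCascade.slackWeight 1 θ c env L' k ≤ Ψ k) ∧ (∀ k : ℤ, 0 ≤ r k ∧ r k < q k ∧ 0 ≤ ρ k ∧ r k + c * ρ k ≤ q k ∧ q k ^ 2 / 2 ≤ env k) ∧ (∀ j : Fin n, 0 ≤ Φ j ∧ Φ j ≤ env (kLo + (j : ℕ)) ∧ M ^ 2 / 2 + η * Ψ (kLo + (j : ℕ)) + η * (1 + 1 : ℝ) ^ ((2 : ℝ) * ((kLo + (j : ℕ) : ℤ) : ℝ))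 * c * Φ j < Φ j) ∧ (∃ M₁ : ℝ, ∀ k : ℤ, kLo + n ≤ k → (1 + (1 + 1 : ℝ) ^ ((10 : ℝ) * (k : ℝ))) * q k ≤ M₁) ∧ v (win (Literature.Analysis.FluidPDE.TaoCascade.datumState i₀ X₀)) ≤ 0 ∧ 0 < g (win (Literature.Analysis.FluidPDE.TaoCascade.datumState i₀ X₀)) ∧ (∀ x : Fin 4 → Fin n → ℝ, v x ≤ 0 → ∀ i j, |x i j| ≤ M) ∧ (∀ x : Fin 4 → Fin n → ℝ, v x ≤ 0 → 0 < g x → -(γ * c) < v x) ∧ (∀ (S F : Fin 4 → ℤ → ℝ), (v (win S) ≤ 0 ∧ (∀ i k, S i k ^ 2 ≤ 2 * F i k) ∧ (∀ i k, 0 ≤ F i k) ∧ (∀ i k, (k < kLo ∨ kLo + n ≤ k) → F i k ≤ q k ^ 2 / 2) ∧ (∀ (i : Fin 4) (j : Fin n), F i (kLo + (j : ℕ)) ≤ Φ j)) → 0 < g (win S) → (fderiv ℝ v (win S)) (fun i j => vf S i (kLo + (j : ℕ))) ≤ -(2 * γ)) ∧ (∀ x : Fin 4 → Fin n → ℝ,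 v x ≤ 0 → ‖fderiv ℝ v x‖ ≤ Λ) ∧ 0 ≤ Λ ∧ (∀ j : Fin n, Λ * (η * (1 + 1 : ℝ) ^ ((2 : ℝ) * ((kLo + (j : ℕ) : ℤ) : ℝ)) * Real.sqrt (Φ j)) ≤ γ) ∧ (∀ (S F : Fin 4 → ℤ → ℝ), (v (win S) ≤ 0 ∧ (∀ i k, S i k ^ 2 ≤ 2 * F i k) ∧ (∀ i k, 0 ≤ F i k) ∧ (∀ i k, (k < kLo ∨ kLo + n ≤ k) → F i k ≤ q k ^ 2 / 2) ∧ (∀ (i : Fin 4) (j : Fin n), F i (kLo + (j : ℕ)) ≤ Φ j)) → ∀ (i : Fin 4) (k : ℤ), (k < kLo ∨ kLo + n ≤ k) → vf S i k * S i k ≤ ρ k * |S i k|) ∧ (∀ (S F : Fin 4 → ℤ → ℝ), (v (win S) ≤ 0 ∧ (∀ i k, S i k ^ 2 ≤ 2 * F i k) ∧ (∀ i k, 0 ≤ F i k) ∧ (∀ i k, (k < kLo ∨ kLo + n ≤ k) → F i k ≤ q k ^ 2 / 2) ∧ (∀ (i : Fin 4) (j : Fin n), F i (kLo + (j : ℕ))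 ≤ Φ j)) → g (win S) ≤ 0 → (1 + 1 : ℝ) ^ (-θ) ≤ |S i₀ 1| ∧ v (win (fun i k => S i (1 + k) / |S i₀ 1|)) ≤ 0 ∧ 0 < g (win (fun i k => S i (1 + k) / |S i₀ 1|)) ∧ (∀ i k, (k < kLo ∨ kLo + n ≤ k) → F i (1 + k) / |S i₀ 1| ^ 2 ≤ r k ^ 2 / 2))

/-- item stmt-NavierStokesRegularity-23424 · assembly · rank 1 · closed · proved by Summit.NavierStokesRegularity.NavierStokesRegularity.Theorems.barrierStepRungThree_assembly_proof (prover) · by planner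
sources: Tao2016AveragedNS
[assembly] BarrierCertificate → BarrierSoundness → RestartControl → RestartGlue →
LocalDynamicsSufficesAt → TaoLadderRungThree.Target -/
@[route_item "route-NavierStokesRegularity-BarrierStepRungThree"]
def Assembly : Prop :=
  BarrierCertificate → BarrierSoundness → RestartControl → RestartGlue → LocalDynamicsSufficesAt → Summit.NavierStokesRegularity.NavierStokesRegularity.Theses.TaoLadderRungThree.Target

-- `Assembly` holds: proved by `Summit.NavierStokesRegularity.NavierStokesRegularity.Theorems.barrierStepRungThree_assembly_proof` (its module imports this route file, so no `_holds` link can be stated here).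

/-! D-0027 §2.1 — DECIDING THEOREM (planner-authored via `route open/edit --closes-file`; by planner-ns-idea-4-g3-0 2026-08-28T01:47:31Z):
its hypotheses are this route's items and its conclusion the registered leaf `Summit.NavierStokesRegularity.NavierStokesRegularity.Theses.TaoLadderRungThree.Target` (rung TL-M3, D-0061) (glue_lint), and it elaborates with this file. -/

@[closes "route-NavierStokesRegularity-BarrierStepRungThree"] theorem closes (h₁ : BarrierCertificateR) (h₂ : BarrierSoundnessR) (h₃ : RestartControl)
    (h₄ : RestartGlue) (h₅ : LocalDynamicsSufficesAt) :
    Summit.NavierStokesRegularity.NavierStokesRegularity.Theses.TaoLadderRungThree.Target := by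
  obtain ⟨R, θ, c, η, γ, i₀, α, X₀, n, kLo, v, g, r, q, ρ, env, Ψ, Mw, Φ, win, vf, hcond⟩ := h₁
  obtain ⟨hP, hstep⟩ := h₂ R θ c η γ i₀ α X₀ n kLo v g r q ρ env Ψ Mw Φ win vf hcond
  obtain ⟨hR, hα, hX₀, hθ0, hθ, hc, hη, -⟩ := hcond
  -- work at a general scale ratio `ε₀ > 0`; specialise to the dyadic `ε₀ = 1` at the end
  obtain ⟨ε₀, hε₀, hε₁⟩ : ∃ ε₀ : ℝ, 0 < ε₀ ∧ ε₀ = 1 := ⟨1, one_pos, rfl⟩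
  rw [← hε₁] at hstep
  have hdyn : Literature.Analysis.FluidPDE.TaoCascade.DynamicsLocalAt ε₀ R := by
    refine ⟨θ, c, i₀, _, X₀, (fun S F => v (win S) ≤ 0 ∧ 0 < g (win S) ∧ (∀ i k, 0 ≤ F i k) ∧ (∀ i k, k < kLo → F i k ≤ r k ^ 2 / 2) ∧ (∀ k : ℤ, kLo + n ≤ k → ∀ L : ℕ, ∑ j ∈ Finset.range L, ∑ i, F i (k + j) ≤ r k ^ 2 / 2) ∧ (∃ D : ℕ, ∀ i k, k + D < kLo → S i k = 0 ∧ F i k = 0) ∧ ∃ B : ℝ, ∀ i k, F i k ≤ B),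
      Literature.Analysis.FluidPDE.TaoCascade.epochEnvelope env, hθ0, by linarith, hc,
      hα, hX₀, hP, ?_⟩
    intro K₁ K₂ hK₁ hK₂
    obtain ⟨N₀, hN₀⟩ := h₃ ε₀ θ c η i₀ _ X₀ (fun S F => v (win S) ≤ 0 ∧ 0 < g (win S) ∧ (∀ i k, 0 ≤ F i k) ∧ (∀ i k, k < kLo → F i k ≤ r k ^ 2 / 2) ∧ (∀ k : ℤ, kLo + n ≤ k → ∀ L : ℕ, ∑ j ∈ Finset.range L, ∑ i, F i (k + j) ≤ r k ^ 2 / 2) ∧ (∃ D : ℕ, ∀ i k, k + D < kLo → S i k = 0 ∧ F i k = 0) ∧ ∃ B : ℝ, ∀ i k, F i k ≤ B) env K₁ K₂ hε₀ hθ hc.le hη hX₀ hK₁ hK₂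
    refine ⟨N₀, fun n₀ hn₀ T hT X E hsol N hN t e hcp hhor => ?_⟩
    have heN : 0 < e N := hcp.e_pos N hN le_rfl
    have hpow : 0 < (1 + ε₀) ^ ((5 : ℝ) * N / 2) := Real.rpow_pos_of_pos (by linarith) _
    have hγ : 0 < e N * (1 + ε₀) ^ ((5 : ℝ) * N / 2) := mul_pos heN hpow
    have hneg : (1 + ε₀) ^ (-(5 : ℝ) * N / 2) = ((1 + ε₀) ^ ((5 : ℝ) * N / 2))⁻¹ := by
      rw [← Real.rpow_neg (by linarith : (0 : ℝ) ≤ 1 + ε₀)]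
      congr 1
      ring
    have hcγ : c * (1 + ε₀) ^ (-(5 : ℝ) * N / 2) * (e N)⁻¹ =
        c / (e N * (1 + ε₀) ^ ((5 : ℝ) * N / 2)) := by
      rw [hneg]
      field_simp
    rw [hcγ] at hhor
    have hdiv : 0 < c / (e N * (1 + ε₀) ^ ((5 : ℝ) * N / 2)) := div_pos hc hγ
    have htN : t N < T := by linarith
    have hτ : c ≤ (T - t N) * (e N * (1 + ε₀) ^ ((5 : ℝ) * N / 2)) := by
      have h2 : c / (e N * (1 + ε₀) ^ ((5 : ℝ) * N / 2)) ≤ T - t N := by linarith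
      have h3 := mul_le_mul_of_nonneg_right h2 hγ.le
      rwa [div_mul_cancel₀ c hγ.ne'] at h3
    obtain ⟨hflow, hslack⟩ := hN₀ n₀ hn₀ T hT X E hsol N hN t e hcp htN
    obtain ⟨τ₁, a, hst⟩ :=
      hstep (N - n₀).toNat _ _ _ (hcp.state N hN le_rfl) hslack _ hτ _ _ hflow
    exact ⟨_, _, h₄ ε₀ θ c 4 i₀ n₀ X₀ _ _ N X E t e τ₁ a hε₀ hN hcp hst⟩
  rw [hε₁] at hdyn
  obtain ⟨α', X₀', hα', hng⟩ := h₅ 1 R one_pos hR hdyn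
  exact ⟨R, hR, α', X₀', hα', hng⟩

end Summit.NavierStokesRegularity.NavierStokesRegularity.Theses.BarrierStepRungThree
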